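import Mathlib
import Summits.KontsevichZagierPeriods.KontsevichZagierPeriods.Theorems.InverseLandauTateFamilyKernelRationalCertificate
import Summits.KontsevichZagierPeriods.KontsevichZagierPeriods.Theorems.InverseLandauTateFamilyKernelStubFaceIntegral
import Summits.KontsevichZagierPeriods.KontsevichZagierPeriods.Theorems.InverseLandauTateFamilyKernelOpenCube

/-!
# Crux `TateFamilyKernel` (stmt-KontsevichZagierPeriods-9130), line `Sketch`
# — stub `stub_boundaryFamily`

The boundary family of an exact form.  Data: Griffiths data `G_k = A_k/D_k` (`k < K`) on the cube
`[0,1]^{N+2}` with the parameter `ϖ` appended last, along coordinates `i_k`, whose denominators are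
Tate (`D_k(w, 0) = c_k ≠ 0` identically) and admissible (`D_k(w, ϖ) ≠ 0` on
`[0,1]^{N+2} × (0, ε)`), and such that the closed-cube integrals of the exact form
`E = Σ_k ∂_{i_k} G_k` vanish for `ϖ ∈ (0, ε)`.  Conclusion: ONE family `P_b/Q_b` in `N + 1` cube
variables,

* `Q_b = ∏_k D_k|_{w_{i_k}=0} · D_k|_{w_{i_k}=1}` (face restrictions are the algebra maps
  `MvPolynomial.aeval` of the substitution `w_{i_k} ↦ b`, remaining cube variables relabelled
  through `Fin.succAbove (i k)`, parameter kept last — `aeval_snoc_faceSubst`), Tate and admissible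
  factorwise (faces of the cube lie in the cube, `insertNth_mem_cube`);
* `P_b = Σ_k (A_k|₁ · D_k|₀ − A_k|₀ · D_k|₁) · ∏_{k' ≠ k} D_{k'}|₀ · D_{k'}|₁`, so that
  `P_b/Q_b = Σ_k (G_k|_{w_{i_k}=1} − G_k|_{w_{i_k}=0})` wherever the factors are non-zero
  (`sum_faceDiff_div_prod`);
* the open-cube integrals of `P_b/Q_b` vanish on `(0, ε)`: open cube = closed cube up to the null
  faces (`setIntegral_pi_Ioo_eq_setIntegral_cube'`), and on the closed cube the integral of the
  summed face differences is the integral of `E` by the divergence theorem (`stub_faceIntegral`,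
  applied to the slices `G_k(·, ϖ)` with the quotient-rule derivative `hasDerivAt_slice_update`).
-/

noncomputable section

open MeasureTheory Set MvPolynomial
open Literature.NumberTheory.Transcendental
open Literature.ModelTheory.ExponentialFields (IsSemialgebraic)
open Summit.KontsevichZagierPeriods.FurushoPentagon.PentagonInKZ.SimplexToCube
  (volume_cube_diff_openUnitCube)

namespace Summit.KontsevichZagierPeriods.InverseLandau.TateFamilyKernel.Descent

/-- **Face substitution, evaluated.** Substituting `w_j ↦ b` (`b ∈ ℚ`), relabelling the other cube
variables through `j.succAbove` and keeping the parameter last, then evaluating at `(x, ϖ)`, is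
evaluating at the face point `(Fin.insertNth j b x, ϖ)`. [folklore] -/
theorem aeval_snoc_faceSubst {N : ℕ} (j : Fin (N + 2)) (b : ℚ)
    (P : MvPolynomial (Fin (N + 2 + 1)) ℚ) (x : Fin (N + 1) → ℝ) (ϖ : ℝ) :
    aeval (Fin.snoc x ϖ : Fin (N + 1 + 1) → ℝ)
      (aeval (Fin.snoc (Fin.insertNth j (C b) (fun t : Fin (N + 1) => X (Fin.castSucc t)))
          (X (Fin.last (N + 1))) : Fin (N + 2 + 1) → MvPolynomial (Fin (N + 1 + 1)) ℚ) P) =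
    aeval (Fin.snoc (Fin.insertNth j (b : ℝ) x) ϖ : Fin (N + 2 + 1) → ℝ) P := by
  have hv : (fun s => aeval (Fin.snoc x ϖ : Fin (N + 1 + 1) → ℝ)
      ((Fin.snoc (Fin.insertNth j (C b) (fun t : Fin (N + 1) => X (Fin.castSucc t)))
          (X (Fin.last (N + 1))) : Fin (N + 2 + 1) → MvPolynomial (Fin (N + 1 + 1)) ℚ) s)) =
      (Fin.snoc (Fin.insertNth j (b : ℝ) x) ϖ : Fin (N + 2 + 1) → ℝ) := by
    funext s
    refine Fin.lastCases ?_ (fun s => ?_) s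
    · simp only [Fin.snoc_last, aeval_X]
    · simp only [Fin.snoc_castSucc]
      induction s using Fin.succAboveCases j with
      | x => simp [Fin.insertNth_apply_same]
      | p t => simp [Fin.insertNth_apply_succAbove]
  rw [← AlgHom.comp_apply, MvPolynomial.comp_aeval, hv]

/-- **Partial fractions, summed.** For non-vanishing `f₀ k`, `f₁ k`,
`(Σ_k (a₁ k · f₀ k − a₀ k · f₁ k) · ∏_{k' ≠ k} f₀ k' · f₁ k') / ∏_k f₀ k · f₁ k`
`= Σ_k (a₁ k / f₁ k − a₀ k / f₀ k)`. [folklore] -/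
theorem sum_faceDiff_div_prod {K : ℕ} (a0 a1 f0 f1 : Fin K → ℝ) (h0 : ∀ k, f0 k ≠ 0)
    (h1 : ∀ k, f1 k ≠ 0) :
    (∑ k, (a1 k * f0 k - a0 k * f1 k) * ∏ k' ∈ Finset.univ.erase k, (f0 k' * f1 k')) /
        ∏ k, (f0 k * f1 k) = ∑ k, (a1 k / f1 k - a0 k / f0 k) := by
  classical
  have hQ : ∏ k, (f0 k * f1 k) ≠ 0 :=
    Finset.prod_ne_zero_iff.2 fun k _ => mul_ne_zero (h0 k) (h1 k)
  rw [div_eq_iff hQ, Finset.sum_mul]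
  refine Finset.sum_congr rfl fun k _ => ?_
  have hP : ∏ k', (f0 k' * f1 k') =
      (f0 k * f1 k) * ∏ k' ∈ Finset.univ.erase k, (f0 k' * f1 k') :=
    (Finset.mul_prod_erase Finset.univ (fun k' => f0 k' * f1 k') (Finset.mem_univ k)).symm
  have hk : (a1 k / f1 k - a0 k / f0 k) * (f0 k * f1 k) = a1 k * f0 k - a0 k * f1 k := by
    have h0k := h0 k
    have h1k := h1 k
    field_simp
  rw [hP, ← mul_assoc, hk]

/-- Open cube versus closed cube: the faces of `[0,1]^M` are Lebesgue-null
(`volume_cube_diff_openUnitCube`), so integrals over `∏ᵢ (0,1)` and over `[0,1]^M` agree.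
[folklore] -/
theorem setIntegral_pi_Ioo_eq_setIntegral_cube' {M : ℕ} (f : (Fin M → ℝ) → ℝ) :
    ∫ w in Set.pi Set.univ (fun _ : Fin M => Ioo (0 : ℝ) 1), f w = ∫ w in KZ.cube M, f w := by
  refine setIntegral_congr_set ?_
  rw [pi_univ_Ioo_eq_openUnitCube]
  refine (ae_eq_set).2 ⟨?_, ?_⟩
  · exact measure_mono_null (fun x hx => (hx.2 (KZ.openUnitCube_subset_cube hx.1)).elim)
      measure_empty
  · exact volume_cube_diff_openUnitCube M

/-- **The boundary family of an exact form** (stub `stub_boundaryFamily` of the crux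
`TateFamilyKernel`, line `Sketch`). Given Griffiths data `G_k = A_k/D_k` on `[0,1]^{N+2}` along
coordinates `i_k` with Tate (`hT`) and admissible (`hadm`) denominators, and the exact form
`E = Σ_k ∂_{i_k} G_k` (the displayed integrand of `hvan` is `∂_{i_k} G_k` by the quotient rule)
with vanishing closed-cube integrals for `ϖ ∈ (0, ε)`, there is ONE family `P_b/Q_b` in `N + 1`
cube variables with `Q_b = ∏_k D_k|_{w_{i_k}=0} · D_k|_{w_{i_k}=1}` Tate and admissible, whose
values on `(0, ε) × [0,1]^{N+1}` are the summed face differences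
`Σ_k (G_k|_{w_{i_k}=1} − G_k|_{w_{i_k}=0})`, and whose open-cube integrals vanish on `(0, ε)`
(divergence theorem `stub_faceIntegral`).
[cite: KontsevichZagier2001, §1.2] -/
theorem stub_boundaryFamily (N K : ℕ) (i : Fin K → Fin (N + 2))
    (A Dn : Fin K → MvPolynomial (Fin (N + 2 + 1)) ℚ) (ε : ℝ) (hε : 0 < ε)
    (hT : ∀ k, ∃ c₀ : ℚ, c₀ ≠ 0 ∧ ∀ w : Fin (N + 2) → ℝ,
      aeval (Fin.snoc w (0 : ℝ) : Fin (N + 2 + 1) → ℝ) (Dn k) = (c₀ : ℝ))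
    (hadm : ∀ k (w : Fin (N + 2) → ℝ) (ϖ : ℝ), (∀ t, w t ∈ Icc (0 : ℝ) 1) → ϖ ∈ Ioo 0 ε →
      aeval (Fin.snoc w ϖ : Fin (N + 2 + 1) → ℝ) (Dn k) ≠ 0)
    (hvan : ∀ ϖ ∈ Ioo (0 : ℝ) ε, ∫ w in KZ.cube (N + 2),
      ∑ k, aeval (Fin.snoc w ϖ : Fin (N + 2 + 1) → ℝ)
          (pderiv (Fin.castSucc (i k)) (A k) * Dn k - A k * pderiv (Fin.castSucc (i k)) (Dn k)) /
        aeval (Fin.snoc w ϖ : Fin (N + 2 + 1) → ℝ) (Dn k ^ 2) = 0) :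
    ∃ (Pb Qb : MvPolynomial (Fin (N + 1 + 1)) ℚ),
      (∃ c₀ : ℚ, c₀ ≠ 0 ∧ ∀ x : Fin (N + 1) → ℝ,
        aeval (Fin.snoc x (0 : ℝ) : Fin (N + 1 + 1) → ℝ) Qb = (c₀ : ℝ)) ∧
      (∀ (x : Fin (N + 1) → ℝ) (ϖ : ℝ), (∀ t, x t ∈ Icc (0 : ℝ) 1) → ϖ ∈ Ioo 0 ε →
        aeval (Fin.snoc x ϖ : Fin (N + 1 + 1) → ℝ) Qb ≠ 0) ∧
      (∀ ϖ ∈ Ioo (0 : ℝ) ε, ∀ x ∈ KZ.cube (N + 1),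
        aeval (Fin.snoc x ϖ : Fin (N + 1 + 1) → ℝ) Pb / aeval (Fin.snoc x ϖ : Fin (N + 1 + 1) → ℝ) Qb =
          ∑ k, (aeval (Fin.snoc (Fin.insertNth (i k) 1 x) ϖ : Fin (N + 2 + 1) → ℝ) (A k) /
                aeval (Fin.snoc (Fin.insertNth (i k) 1 x) ϖ : Fin (N + 2 + 1) → ℝ) (Dn k) -
              aeval (Fin.snoc (Fin.insertNth (i k) 0 x) ϖ : Fin (N + 2 + 1) → ℝ) (A k) /
                aeval (Fin.snoc (Fin.insertNth (i k) 0 x) ϖ : Fin (N + 2 + 1) → ℝ) (Dn k))) ∧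
      (∀ ϖ ∈ Ioo (0 : ℝ) ε, ∫ x in Set.pi Set.univ (fun _ : Fin (N + 1) => Ioo (0 : ℝ) 1),
        aeval (Fin.snoc x ϖ : Fin (N + 1 + 1) → ℝ) Pb / aeval (Fin.snoc x ϖ : Fin (N + 1 + 1) → ℝ) Qb = 0) := by
  classical
  have _hε := hε
  /- Step 1: face substitutions `v j b` and their evaluation. -/
  obtain ⟨v, hv⟩ : ∃ v : Fin (N + 2) → ℚ → (Fin (N + 2 + 1) → MvPolynomial (Fin (N + 1 + 1)) ℚ),
      v = fun j b => (Fin.snoc (Fin.insertNth j (C b) (fun t : Fin (N + 1) => X (Fin.castSucc t)))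
        (X (Fin.last (N + 1))) : Fin (N + 2 + 1) → MvPolynomial (Fin (N + 1 + 1)) ℚ) := ⟨_, rfl⟩
  have hev : ∀ (j : Fin (N + 2)) (b : ℚ) (P : MvPolynomial (Fin (N + 2 + 1)) ℚ)
      (x : Fin (N + 1) → ℝ) (ϖ : ℝ),
      aeval (Fin.snoc x ϖ : Fin (N + 1 + 1) → ℝ) (aeval (v j b) P) =
        aeval (Fin.snoc (Fin.insertNth j (b : ℝ) x) ϖ : Fin (N + 2 + 1) → ℝ) P := by
    intro j b P x ϖ
    rw [hv]
    exact aeval_snoc_faceSubst j b P x ϖ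
  /- Step 2: the restricted numerators and denominators. -/
  obtain ⟨D0, hD0⟩ : ∃ D0 : Fin K → MvPolynomial (Fin (N + 1 + 1)) ℚ,
      ∀ k, D0 k = aeval (v (i k) 0) (Dn k) := ⟨_, fun _ => rfl⟩
  obtain ⟨D1, hD1⟩ : ∃ D1 : Fin K → MvPolynomial (Fin (N + 1 + 1)) ℚ,
      ∀ k, D1 k = aeval (v (i k) 1) (Dn k) := ⟨_, fun _ => rfl⟩
  obtain ⟨A0, hA0⟩ : ∃ A0 : Fin K → MvPolynomial (Fin (N + 1 + 1)) ℚ,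
      ∀ k, A0 k = aeval (v (i k) 0) (A k) := ⟨_, fun _ => rfl⟩
  obtain ⟨A1, hA1⟩ : ∃ A1 : Fin K → MvPolynomial (Fin (N + 1 + 1)) ℚ,
      ∀ k, A1 k = aeval (v (i k) 1) (A k) := ⟨_, fun _ => rfl⟩
  have eD0 : ∀ (x : Fin (N + 1) → ℝ) (ϖ : ℝ) (k : Fin K),
      aeval (Fin.snoc x ϖ : Fin (N + 1 + 1) → ℝ) (D0 k) =
        aeval (Fin.snoc (Fin.insertNth (i k) 0 x) ϖ : Fin (N + 2 + 1) → ℝ) (Dn k) := by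
    intro x ϖ k
    rw [hD0, hev, Rat.cast_zero]
  have eD1 : ∀ (x : Fin (N + 1) → ℝ) (ϖ : ℝ) (k : Fin K),
      aeval (Fin.snoc x ϖ : Fin (N + 1 + 1) → ℝ) (D1 k) =
        aeval (Fin.snoc (Fin.insertNth (i k) 1 x) ϖ : Fin (N + 2 + 1) → ℝ) (Dn k) := by
    intro x ϖ k
    rw [hD1, hev, Rat.cast_one]
  have eA0 : ∀ (x : Fin (N + 1) → ℝ) (ϖ : ℝ) (k : Fin K),
      aeval (Fin.snoc x ϖ : Fin (N + 1 + 1) → ℝ) (A0 k) =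
        aeval (Fin.snoc (Fin.insertNth (i k) 0 x) ϖ : Fin (N + 2 + 1) → ℝ) (A k) := by
    intro x ϖ k
    rw [hA0, hev, Rat.cast_zero]
  have eA1 : ∀ (x : Fin (N + 1) → ℝ) (ϖ : ℝ) (k : Fin K),
      aeval (Fin.snoc x ϖ : Fin (N + 1 + 1) → ℝ) (A1 k) =
        aeval (Fin.snoc (Fin.insertNth (i k) 1 x) ϖ : Fin (N + 2 + 1) → ℝ) (A k) := by
    intro x ϖ k
    rw [hA1, hev, Rat.cast_one]
  /- Step 3: face points lie in the cube; admissibility of the restricted denominators. -/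
  have h0I : (0 : ℝ) ∈ Icc (0 : ℝ) 1 := ⟨le_rfl, zero_le_one⟩
  have h1I : (1 : ℝ) ∈ Icc (0 : ℝ) 1 := ⟨zero_le_one, le_rfl⟩
  have hDk : ∀ ϖ ∈ Ioo (0 : ℝ) ε, ∀ k, ∀ w ∈ KZ.cube (N + 2),
      aeval (Fin.snoc w ϖ : Fin (N + 2 + 1) → ℝ) (Dn k) ≠ 0 :=
    fun ϖ hϖ k w hw => hadm k w ϖ (fun t => hw t) hϖ
  have hD0ne : ∀ ϖ ∈ Ioo (0 : ℝ) ε, ∀ x ∈ KZ.cube (N + 1), ∀ k,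
      aeval (Fin.snoc x ϖ : Fin (N + 1 + 1) → ℝ) (D0 k) ≠ 0 := fun ϖ hϖ x hx k => by
    rw [eD0]
    exact hDk ϖ hϖ k _ (insertNth_mem_cube (i k) h0I hx)
  have hD1ne : ∀ ϖ ∈ Ioo (0 : ℝ) ε, ∀ x ∈ KZ.cube (N + 1), ∀ k,
      aeval (Fin.snoc x ϖ : Fin (N + 1 + 1) → ℝ) (D1 k) ≠ 0 := fun ϖ hϖ x hx k => by
    rw [eD1]
    exact hDk ϖ hϖ k _ (insertNth_mem_cube (i k) h1I hx)
  /- Step 4: the family and its pointwise values. -/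
  have hval : ∀ ϖ ∈ Ioo (0 : ℝ) ε, ∀ x ∈ KZ.cube (N + 1),
      aeval (Fin.snoc x ϖ : Fin (N + 1 + 1) → ℝ)
          (∑ k, (A1 k * D0 k - A0 k * D1 k) * ∏ k' ∈ Finset.univ.erase k, (D0 k' * D1 k')) /
        aeval (Fin.snoc x ϖ : Fin (N + 1 + 1) → ℝ) (∏ k, (D0 k * D1 k)) =
      ∑ k, (aeval (Fin.snoc (Fin.insertNth (i k) 1 x) ϖ : Fin (N + 2 + 1) → ℝ) (A k) /
            aeval (Fin.snoc (Fin.insertNth (i k) 1 x) ϖ : Fin (N + 2 + 1) → ℝ) (Dn k) -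
          aeval (Fin.snoc (Fin.insertNth (i k) 0 x) ϖ : Fin (N + 2 + 1) → ℝ) (A k) /
            aeval (Fin.snoc (Fin.insertNth (i k) 0 x) ϖ : Fin (N + 2 + 1) → ℝ) (Dn k)) := by
    intro ϖ hϖ x hx
    simp only [map_sum, map_prod, map_mul, map_sub]
    rw [sum_faceDiff_div_prod _ _ _ _ (hD0ne ϖ hϖ x hx) (hD1ne ϖ hϖ x hx)]
    simp only [eD0, eD1, eA0, eA1]
  refine ⟨∑ k, (A1 k * D0 k - A0 k * D1 k) * ∏ k' ∈ Finset.univ.erase k, (D0 k' * D1 k'),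
    ∏ k, (D0 k * D1 k), ?_, ?_, hval, ?_⟩
  · /- Tate: `Q_b(x, 0) = ∏_k c_k · c_k`. -/
    choose c hc0 hc using hT
    refine ⟨∏ k, (c k * c k), Finset.prod_ne_zero_iff.2 fun k _ => mul_ne_zero (hc0 k) (hc0 k),
      fun x => ?_⟩
    rw [map_prod, Rat.cast_prod]
    refine Finset.prod_congr rfl fun k _ => ?_
    rw [map_mul, Rat.cast_mul, eD0, eD1, hc, hc]
  · /- admissible -/
    intro x ϖ hx hϖ
    rw [map_prod]
    exact Finset.prod_ne_zero_iff.2 fun k _ => by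
      rw [map_mul]
      exact mul_ne_zero (hD0ne ϖ hϖ x (fun t => hx t) k) (hD1ne ϖ hϖ x (fun t => hx t) k)
  · /- vanishing open-cube integrals -/
    intro ϖ hϖ
    obtain ⟨G, hG⟩ : ∃ G : Fin K → (Fin (N + 2) → ℝ) → ℝ, G = fun k w =>
        aeval (Fin.snoc w ϖ : Fin (N + 2 + 1) → ℝ) (A k) /
          aeval (Fin.snoc w ϖ : Fin (N + 2 + 1) → ℝ) (Dn k) := ⟨_, rfl⟩
    obtain ⟨G', hG'⟩ : ∃ G' : Fin K → (Fin (N + 2) → ℝ) → ℝ, G' = fun k w =>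
        aeval (Fin.snoc w ϖ : Fin (N + 2 + 1) → ℝ)
            (pderiv (Fin.castSucc (i k)) (A k) * Dn k - A k * pderiv (Fin.castSucc (i k)) (Dn k)) /
          aeval (Fin.snoc w ϖ : Fin (N + 2 + 1) → ℝ) (Dn k ^ 2) := ⟨_, rfl⟩
    have hGa : ∀ k ∈ (Finset.univ : Finset (Fin K)),
        AnalyticOnNhd ℝ (G k) (KZ.cube (N + 2)) :=
      fun k _ => by
        rw [hG]
        exact analyticOnNhd_slice (A k) (Dn k) ϖ (hDk ϖ hϖ k)
    have hder : ∀ k ∈ (Finset.univ : Finset (Fin K)), ∀ w ∈ KZ.cube (N + 2),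
        HasDerivAt (fun t : ℝ => G k (Function.update w (i k) t)) (G' k w) (w (i k)) :=
      fun k _ w hw => by
        rw [hG, hG']
        exact hasDerivAt_slice_update (A k) (Dn k) ϖ (i k) w (hDk ϖ hϖ k w hw)
    have hG'c : ∀ k ∈ (Finset.univ : Finset (Fin K)), ContinuousOn (G' k) (KZ.cube (N + 2)) :=
      fun k _ => by
        rw [hG']
        exact (analyticOnNhd_slice _ (Dn k ^ 2) ϖ fun w hw => by
          rw [map_pow]; exact pow_ne_zero 2 (hDk ϖ hϖ k w hw)).continuousOn
    have hStokes := stub_faceIntegral Finset.univ i hGa hder hG'c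
    have h0 : ∫ w in KZ.cube (N + 2), ∑ k, G' k w = 0 := by
      rw [hG']
      exact hvan ϖ hϖ
    have hface : ∀ k (b : ℝ), b ∈ Icc (0 : ℝ) 1 →
        IntegrableOn (fun x : Fin (N + 1) → ℝ => G k (Fin.insertNth (i k) b x))
          (KZ.cube (N + 1)) :=
      fun k b hb => (analyticOnNhd_comp_insertNth (hGa k (Finset.mem_univ k)) (i k)
        hb).continuousOn.integrableOn_compact KZ.isCompact_cube
    have h1 : ∫ x in KZ.cube (N + 1),
        ∑ k, (G k (Fin.insertNth (i k) 1 x) - G k (Fin.insertNth (i k) 0 x)) = 0 := by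
      have hsub : ∀ k, ∫ x in KZ.cube (N + 1),
          (G k (Fin.insertNth (i k) 1 x) - G k (Fin.insertNth (i k) 0 x)) =
          (∫ x in KZ.cube (N + 1), G k (Fin.insertNth (i k) 1 x)) -
            ∫ x in KZ.cube (N + 1), G k (Fin.insertNth (i k) 0 x) :=
        fun k => integral_sub (hface k 1 h1I) (hface k 0 h0I)
      rw [integral_finsetSum]
      · simp only [hsub]
        rw [← hStokes]
        exact h0
      · intro k _
        exact (hface k 1 h1I).sub (hface k 0 h0I)
    rw [setIntegral_pi_Ioo_eq_setIntegral_cube',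
      setIntegral_congr_fun KZ.measurableSet_cube (fun x hx => hval ϖ hϖ x hx)]
    simpa only [hG] using h1

end Summit.KontsevichZagierPeriods.InverseLandau.TateFamilyKernel.Descent

end
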